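import Summits.AtomisticToContinuum.HydrodynamicLimit.Theorems.MourreKoopmanChargesLinearToEntropyInBandDefsB
import Summits.AtomisticToContinuum.HydrodynamicLimit.Theorems.MourreKoopmanChargesLinearToEntropyInBandThroughputOfEnvelope
import Summits.AtomisticToContinuum.HydrodynamicLimit.Theses.BGEndpointRigidity
import Literature.Analysis.FluidPDE.EmpiricalCollisionMeasureMeasurable
import HarnessLib

/-!
# Crux `MourreKoopmanCharges.LinearToEntropyInBand` (stmt-AtomisticToContinuum-17740), line `registered`:
# wave-6 glue — the invisible-collision throughput from its FAST and DENSE halves (skeleton v7, stub I)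

Helper file (`--supports stmt-AtomisticToContinuum-17740`).  Stub I of skeleton v7 posits
`InvisibleCollisionThroughputInBand := ∃ η > 0, InvisibleCollisionThroughputW η` (DefsB § (a)): the per-window
throughput of collisions with a FAST OR MESOSCOPICALLY DENSE endpoint is `o(1)` under the true law.  Its fast
half `FastCollisionThroughputW η` (DefsB § (b)) is PROVED from the Lanford envelope (`stub_throughputOfEnvelopeR`);
its dense half is not.  This file lands the bookkeeping that survives every re-typing of the dense half:

* §1 `aemeasurable_fastWindowThroughput` — the per-window FAST throughput functional (the integrand of
  `FastCollisionThroughputW`, raw `finsum` over collision times with `Function.leftLim` velocities) is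
  a.e.-measurable under every law carried by the good set.  This is what an ADDITIVE split of a `lintegral`
  needs (`lintegral_add_left'`; the lower Lebesgue integral is only super-additive without measurability).
  Proof: on the good set the functional is the pointwise limit of the collision sums
  `collisionSum (Ioc s (s + w)) (φₙ ∘ mark)` of CONTINUOUS mark functionals `φₙ` (the open fast indicator
  `K < max(‖v⁻‖, ‖v⁺‖)` ramped by `min 1 (max 0 (n ·))`, the post-collisional velocity read off the mark by the
  unit-normal reflection formula), which are measurable in the datum by the Literature theorem
  `HardSphereFlow.measurable_indicator_collisionSum_Ioc` (velocity-jump detection); at a collision time only the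
  two partners jump (`leftLim_eq_collidePair`, `contactPairs_eq_pair`, `ofConfig_preVel_eq_leftLim`).
* §2 `glue_invisibleThroughput_of_fast_and_dense` (REGISTERED glue) — for every packing level `η`,
  `FastCollisionThroughputW η →` (the DENSE-only throughput, inline: the integrand of DefsB § (a) with the
  indicator restricted to its dense disjunct `(5/4) ρ_{s'}(xᵢ) < (N+1)⁻¹ Σⱼ cone R N xᵢ xⱼ`, same quantifier
  shell) `→ InvisibleCollisionThroughputW η`: `𝟙(A ∨ B) w ≤ 𝟙(A) w + 𝟙(B) w` termwise on the good set (finite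
  collision-time sets, `IsHardSphereTrajectory.locFinite`), thresholds merged by `max`, `η'/2 + η'/2`.

No definitions; nothing here restates the crux, the route's items or the Statement.  References: H.-T. Yau,
Lett. Math. Phys. 22 (1991) §2; C. Cercignani, R. Illner, M. Pulvirenti, *The Mathematical Theory of Dilute
Gases* (1994) §4.2.
-/

noncomputable section

open MeasureTheory Filter Set Topology
open scoped ENNReal InnerProductSpace BigOperators

namespace Summit.AtomisticToContinuum.HydrodynamicLimit.Theorems.LTEInBand

open Literature.Analysis.FluidPDE Literature.MathematicalPhysics.KineticTheory
open Summit.AtomisticToContinuum.HydrodynamicLimit.Theses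

/-! ## §1 The fast window throughput is a.e.-measurable -/

/-- The ramp `min 1 (max 0 (n x))` tends to the indicator of `0 < x` as `n → ∞`. -/
theorem tendsto_ramp_indicator (x : ℝ) :
    Tendsto (fun n : ℕ => min 1 (max 0 ((n : ℝ) * x))) atTop (𝓝 (if 0 < x then 1 else 0)) := by
  by_cases hx : 0 < x
  · rw [if_pos hx]
    refine tendsto_atTop_of_eventually_const (i₀ := ⌈x⁻¹⌉₊) fun n hn => ?_
    have h1 : (1 : ℝ) ≤ n * x := by
      have hle : x⁻¹ ≤ n := (Nat.le_ceil _).trans (Nat.cast_le.2 hn)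
      calc (1 : ℝ) = x⁻¹ * x := (inv_mul_cancel₀ hx.ne').symm
        _ ≤ n * x := mul_le_mul_of_nonneg_right hle hx.le
    rw [max_eq_right (zero_le_one.trans h1), min_eq_left h1]
  · rw [if_neg hx]
    refine tendsto_const_nhds.congr fun n => ?_
    have h0 : (n : ℝ) * x ≤ 0 := mul_nonpos_of_nonneg_of_nonpos (Nat.cast_nonneg n) (not_lt.1 hx)
    rw [max_eq_left h0, min_eq_right zero_le_one]

/-- The ramped jump weight tends to the jump weight `W_K(a, b) = 𝟙{K < max(‖a‖, ‖b‖)} (1 + ‖b + a‖/2) ‖b − a‖`. -/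
theorem tendsto_ramp_jumpWeight (K : ℝ) (a b : V3) :
    Tendsto (fun n : ℕ => min 1 (max 0 ((n : ℝ) * (max ‖a‖ ‖b‖ - K))) * ((1 + ‖b + a‖ / 2) * ‖b - a‖))
      atTop (𝓝 (if K < max ‖a‖ ‖b‖ then (1 + ‖b + a‖ / 2) * ‖b - a‖ else 0)) := by
  have h := (tendsto_ramp_indicator (max ‖a‖ ‖b‖ - K)).mul_const ((1 + ‖b + a‖ / 2) * ‖b - a‖)
  by_cases hK : K < max ‖a‖ ‖b‖
  · have h' : 0 < max ‖a‖ ‖b‖ - K := sub_pos.2 hK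
    rw [if_pos hK]
    rw [if_pos h'] at h
    simpa using h
  · have h' : ¬ 0 < max ‖a‖ ‖b‖ - K := fun h'' => hK (sub_pos.1 h'')
    rw [if_neg hK]
    rw [if_neg h'] at h
    simpa using h

/-- **Post-collisional velocity from the mark.**  At a collision of the ordered pair `(i, j)` of a hard-sphere
trajectory on `𝕋³` (diameter `ε > 0`), with `c` the record read off the post-collisional configuration: the first
pre-collisional velocity of the record is `vᵢ(t⁻)`, and the unit-normal reflection formula applied to the mark
returns `vᵢ(t)`: `vᵢ⁻ − ⟪vᵢ⁻ − vⱼ⁻, ω⟫ ω = vᵢ(t)`, `ω = ε⁻¹ (xᵢ − xⱼ)` (the elastic law is an involution). -/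
theorem mark_kinematics {n : ℕ} {ε : ℝ} (hε : 0 < ε) {γ : ℝ → Config n (Fin 3) T3}
    (h : IsHardSphereTrajectory (Torus.geometry (Fin 3)) ε n γ) {t : ℝ} {i j : Fin n}
    (hp : (i, j) ∈ contactPairs (Torus.geometry (Fin 3)) ε (γ t)) :
    (HardSphereCollisionRecord.ofConfig (Torus.geometry (Fin 3)) ε (γ t) t i j).preVel.1 =
        (Function.leftLim γ t i).2 ∧
      (HardSphereCollisionRecord.ofConfig (Torus.geometry (Fin 3)) ε (γ t) t i j).preVel.1 -
          ⟪(HardSphereCollisionRecord.ofConfig (Torus.geometry (Fin 3)) ε (γ t) t i j).preVel.1 -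
              (HardSphereCollisionRecord.ofConfig (Torus.geometry (Fin 3)) ε (γ t) t i j).preVel.2,
            (HardSphereCollisionRecord.ofConfig (Torus.geometry (Fin 3)) ε (γ t) t i j).impactVec⟫_ℝ •
          (HardSphereCollisionRecord.ofConfig (Torus.geometry (Fin 3)) ε (γ t) t i j).impactVec = (γ t i).2 := by
  obtain ⟨_, hc⟩ := mem_contactPairs.1 hp
  have hpre := h.ofConfig_preVel_eq_leftLim hp
  refine ⟨by rw [hpre], ?_⟩
  -- the post-collisional pair is the reflection of the pre-collisional one (involution)
  have hnorm : ‖(Torus.geometry (Fin 3)).sepVec (γ t i).1 (γ t j).1‖ = ε := (mem_contactSet.1 hc).2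
  have hpost : ((γ t i).2, (γ t j).2) = reflectVel ((Torus.geometry (Fin 3)).sepVec (γ t i).1 (γ t j).1)
      (HardSphereCollisionRecord.ofConfig (Torus.geometry (Fin 3)) ε (γ t) t i j).preVel := by
    rw [HardSphereCollisionRecord.ofConfig_preVel, reflectVel_reflectVel]
  have h1 : (γ t i).2 = (reflectVel ((Torus.geometry (Fin 3)).sepVec (γ t i).1 (γ t j).1)
      (HardSphereCollisionRecord.ofConfig (Torus.geometry (Fin 3)) ε (γ t) t i j).preVel).1 := by
    rw [← hpost]
  conv_rhs => rw [h1]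
  rw [HardSphereCollisionRecord.ofConfig_impactVec]
  simp only [reflectVel, inner_smul_right, smul_smul, hnorm]
  congr 1
  have hε0 : ε ≠ 0 := hε.ne'
  field_simp

/-- **Only the partners jump.**  At a collision time of a hard-sphere trajectory on `𝕋³` (regular diameter), for
every weight `W` vanishing on the diagonal, `Σᵢ W(vᵢ(t⁻), vᵢ(t))` is the sum over the two ORDERED contact pairs
of `W` at the first partner. -/
theorem sum_jump_eq_sum_contactPairs {n : ℕ} {ε : ℝ} {γ : ℝ → Config n (Fin 3) T3}
    (h : IsHardSphereTrajectory (Torus.geometry (Fin 3)) ε n γ)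
    (hG : (Torus.geometry (Fin 3)).IsHardSphereRegular ε) (W : V3 → V3 → ℝ) (hW : ∀ a, W a a = 0)
    {t : ℝ} (ht : t ∈ collisionTimes (Torus.geometry (Fin 3)) ε γ) :
    ∑ i : Fin n, W (Function.leftLim γ t i).2 (γ t i).2 =
      ∑ p ∈ contactPairs (Torus.geometry (Fin 3)) ε (γ t), W (Function.leftLim γ t p.1).2 (γ t p.1).2 := by
  classical
  obtain ⟨⟨p, q⟩, hpq⟩ := mem_collisionTimes_iff_contactPairs_nonempty.1 ht
  obtain ⟨hne, hc⟩ := mem_contactPairs.1 hpq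
  have hL : Function.leftLim γ t = collidePair (Torus.geometry (Fin 3)) p q (γ t) := h.leftLim_eq_collidePair hne hc
  have hpair : contactPairs (Torus.geometry (Fin 3)) ε (γ t) = {(p, q), (q, p)} := h.contactPairs_eq_pair hG hpq
  have hne' : (p, q) ≠ (q, p) := fun hpe => hne (Prod.mk.inj hpe).1
  rw [hpair, Finset.sum_pair hne']
  refine Finset.sum_eq_add_of_mem p q (Finset.mem_univ _) (Finset.mem_univ _) hne ?_
  intro k _ hk
  rw [hL, collidePair_apply_of_ne hk.1 hk.2]
  exact hW _

/-- **The fast window throughput of one trajectory is the limit of continuous collision sums.**  Along a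
hard-sphere trajectory on `𝕋³` (diameter `ε > 0`, regular), the collision sums over `(s, s + w]` of the ramped mark
functionals `φₙ(t, x, ω, a, b) = min(1, max(0, n (max(‖a‖, ‖a⁺‖) − K))) (1 + ‖a⁺ + a‖/2) ‖a⁺ − a‖`,
`a⁺ = a − ⟪a − b, ω⟫ ω`, tend to `Σᵢ Σ_{collision times s' ∈ (s, s + w]} W_K(vᵢ(s'⁻), vᵢ(s'))`. -/
theorem tendsto_collisionSum_ramp {n : ℕ} {ε : ℝ} (hε : 0 < ε) {γ : ℝ → Config n (Fin 3) T3}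
    (h : IsHardSphereTrajectory (Torus.geometry (Fin 3)) ε n γ)
    (hG : (Torus.geometry (Fin 3)).IsHardSphereRegular ε) (K s w : ℝ) :
    Tendsto (fun m : ℕ => collisionSum (Torus.geometry (Fin 3)) ε γ (Set.Ioc s (s + w))
        (fun c => (fun q : ℝ × T3 × V3 × V3 × V3 =>
          min 1 (max 0 ((m : ℝ) * (max ‖q.2.2.2.1‖ ‖q.2.2.2.1 - ⟪q.2.2.2.1 - q.2.2.2.2, q.2.2.1⟫_ℝ • q.2.2.1‖ - K))) *
            ((1 + ‖(q.2.2.2.1 - ⟪q.2.2.2.1 - q.2.2.2.2, q.2.2.1⟫_ℝ • q.2.2.1) + q.2.2.2.1‖ / 2) *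
              ‖(q.2.2.2.1 - ⟪q.2.2.2.1 - q.2.2.2.2, q.2.2.1⟫_ℝ • q.2.2.1) - q.2.2.2.1‖)) c.mark))
      atTop (𝓝 (∑ i : Fin n, ∑ᶠ s' ∈ collisionTimes (Torus.geometry (Fin 3)) ε γ ∩ Set.Ioc s (s + w),
        (if K < max ‖(Function.leftLim γ s' i).2‖ ‖(γ s' i).2‖
          then (1 + ‖(γ s' i).2 + (Function.leftLim γ s' i).2‖ / 2) * ‖(γ s' i).2 - (Function.leftLim γ s' i).2‖
          else 0))) := by
  classical
  have hfin : (collisionTimes (Torus.geometry (Fin 3)) ε γ ∩ Set.Ioc s (s + w)).Finite :=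
    (h.locFinite s (s + w)).subset (Set.inter_subset_inter_right _ Set.Ioc_subset_Icc_self)
  -- both sides as finite sums over the collision times of the window and the ordered contact pairs
  have hR : (∑ i : Fin n, ∑ᶠ s' ∈ collisionTimes (Torus.geometry (Fin 3)) ε γ ∩ Set.Ioc s (s + w),
        (if K < max ‖(Function.leftLim γ s' i).2‖ ‖(γ s' i).2‖
          then (1 + ‖(γ s' i).2 + (Function.leftLim γ s' i).2‖ / 2) * ‖(γ s' i).2 - (Function.leftLim γ s' i).2‖
          else 0)) =
      ∑ t ∈ hfin.toFinset, ∑ p ∈ contactPairs (Torus.geometry (Fin 3)) ε (γ t),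
        (if K < max ‖(Function.leftLim γ t p.1).2‖ ‖(γ t p.1).2‖
          then (1 + ‖(γ t p.1).2 + (Function.leftLim γ t p.1).2‖ / 2) * ‖(γ t p.1).2 - (Function.leftLim γ t p.1).2‖
          else 0) := by
    simp_rw [finsum_mem_eq_finite_toFinset_sum _ hfin]
    rw [Finset.sum_comm]
    refine Finset.sum_congr rfl fun t ht => ?_
    exact sum_jump_eq_sum_contactPairs h hG
      (fun a b => if K < max ‖a‖ ‖b‖ then (1 + ‖b + a‖ / 2) * ‖b - a‖ else 0) (fun a => by simp)
      ((Set.Finite.mem_toFinset hfin).1 ht).1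
  simp_rw [collisionSum_eq_finset_sum hfin]
  rw [hR]
  refine tendsto_finsetSum _ fun t _ => tendsto_finsetSum _ fun p hp => ?_
  -- one record: the mark determines `(vᵢ(t⁻), vᵢ(t))` of the first partner
  obtain ⟨hpre, hpost⟩ := mark_kinematics hε h (i := p.1) (j := p.2) hp
  simp only [HardSphereCollisionRecord.mark_def]
  rw [hpost, hpre]
  exact tendsto_ramp_jumpWeight K _ _

/-- **A.e.-measurability by continuous collision-sum approximation.**  Along a hard-sphere flow on `𝕋³` with a
regular diameter, a real functional of the datum which, on the good set, is the pointwise limit of the collision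
sums over `(a, b]` of a sequence of CONTINUOUS mark functionals, is a.e.-measurable under every law carried by the
good set (`HardSphereFlow.measurable_indicator_collisionSum_Ioc` + `measurable_of_tendsto_metrizable`). -/
theorem aemeasurable_of_tendsto_collisionSum {ε : ℝ} {N : ℕ}
    (Φ : HardSphereFlow (Torus.geometry (Fin 3)) ε N) (hG : (Torus.geometry (Fin 3)).IsHardSphereRegular ε)
    (P : Measure (Config N (Fin 3) T3)) (hP : P Φ.goodᶜ = 0) (a b : ℝ)
    (f : ℕ → ℝ × T3 × V3 × V3 × V3 → ℝ) (hf : ∀ n, Continuous (f n)) (raw : Config N (Fin 3) T3 → ℝ)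
    (hlim : ∀ z ∈ Φ.good,
      Tendsto (fun n => Φ.collisionSum (Set.Ioc a b) (fun c => f n c.mark) z) atTop (𝓝 (raw z))) :
    AEMeasurable raw P := by
  have hmeas : ∀ n, Measurable (Φ.good.indicator fun z => Φ.collisionSum (Set.Ioc a b) (fun c => f n c.mark) z) :=
    fun n => Φ.measurable_indicator_collisionSum_Ioc hG Torus.isMeasurable_geometry (hf n) (hf n).measurable a b
  have hind : Measurable (Φ.good.indicator raw) := by
    refine measurable_of_tendsto_metrizable hmeas ?_
    rw [tendsto_pi_nhds]
    intro z
    by_cases hz : z ∈ Φ.good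
    · simp only [indicator_of_mem hz]
      exact hlim z hz
    · simp only [indicator_of_notMem hz]
      exact tendsto_const_nhds
  refine ⟨Φ.good.indicator raw, hind, ?_⟩
  filter_upwards [mem_ae_iff.2 hP] with z hz
  rw [indicator_of_mem hz]

/-- **The per-window FAST throughput is a.e.-measurable under every law carried by the good set** (`0 < σ < 1/2`,
so that the torus geometry is regular at the diameter `ε_N ≤ σ`): the functional
`z ↦ c · Σᵢ Σ_{collision times s' ∈ (s, s + w]} 𝟙{K < max(‖vᵢ(s'⁻)‖, ‖vᵢ(s')‖)} (1 + ‖vᵢ(s') + vᵢ(s'⁻)‖/2) ‖vᵢ(s') − vᵢ(s'⁻)‖`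
(the integrand of `FastCollisionThroughputW`, inside `ENNReal.ofReal`). -/
theorem aemeasurable_fastWindowThroughput {σ : ℝ} (hσ : 0 < σ) (hσ2 : σ < 1 / 2) {N : ℕ}
    (Φ : HardSphereFlow (Torus.geometry (Fin 3)) (hsDiameter σ N) (N + 1))
    (P : Measure (Config (N + 1) (Fin 3) T3)) (hP : P Φ.goodᶜ = 0) (K c s w : ℝ) :
    AEMeasurable (fun z => ENNReal.ofReal (c * ∑ i : Fin (N + 1),
      ∑ᶠ s' ∈ collisionTimes (Torus.geometry (Fin 3)) (hsDiameter σ N) (fun r => Φ.flow r z) ∩ Set.Ioc s (s + w),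
        (if K < max ‖(Function.leftLim (fun r => Φ.flow r z) s' i).2‖ ‖(Φ.flow s' z i).2‖
          then (1 + ‖(Φ.flow s' z i).2 + (Function.leftLim (fun r => Φ.flow r z) s' i).2‖ / 2) *
            ‖(Φ.flow s' z i).2 - (Function.leftLim (fun r => Φ.flow r z) s' i).2‖ else 0))) P := by
  have hε : 0 < hsDiameter σ N := hsDiameter_pos hσ N
  have hG : (Torus.geometry (Fin 3)).IsHardSphereRegular (hsDiameter σ N) :=
    Torus.isHardSphereRegular_geometry ((hsDiameter_le hσ.le N).trans_lt (hσ2.trans_eq (by norm_num)))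
  have hraw : AEMeasurable (fun z => ∑ i : Fin (N + 1),
      ∑ᶠ s' ∈ collisionTimes (Torus.geometry (Fin 3)) (hsDiameter σ N) (fun r => Φ.flow r z) ∩ Set.Ioc s (s + w),
        (if K < max ‖(Function.leftLim (fun r => Φ.flow r z) s' i).2‖ ‖(Φ.flow s' z i).2‖
          then (1 + ‖(Φ.flow s' z i).2 + (Function.leftLim (fun r => Φ.flow r z) s' i).2‖ / 2) *
            ‖(Φ.flow s' z i).2 - (Function.leftLim (fun r => Φ.flow r z) s' i).2‖ else 0)) P := by
    refine aemeasurable_of_tendsto_collisionSum Φ hG P hP s (s + w)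
      (fun (m : ℕ) (q : ℝ × T3 × V3 × V3 × V3) =>
          min 1 (max 0 ((m : ℝ) * (max ‖q.2.2.2.1‖ ‖q.2.2.2.1 - ⟪q.2.2.2.1 - q.2.2.2.2, q.2.2.1⟫_ℝ • q.2.2.1‖ - K))) *
            ((1 + ‖(q.2.2.2.1 - ⟪q.2.2.2.1 - q.2.2.2.2, q.2.2.1⟫_ℝ • q.2.2.1) + q.2.2.2.1‖ / 2) *
              ‖(q.2.2.2.1 - ⟪q.2.2.2.1 - q.2.2.2.2, q.2.2.1⟫_ℝ • q.2.2.1) - q.2.2.2.1‖))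
      (fun m => by fun_prop) _ fun z hz => ?_
    exact tendsto_collisionSum_ramp hε (Φ.isTrajectory z hz) hG K s w
  exact ENNReal.measurable_ofReal.comp_aemeasurable (hraw.const_mul c)

/-! ## §2 The registered glue: invisible throughput from its fast and dense halves -/

/-- `𝟙(A ∨ B) w ≤ 𝟙(A) w + 𝟙(B) w` for a non-negative weight `w` (any decidability instances). -/
theorem ite_or_le_add {A B : Prop} [Decidable A] [Decidable B] [Decidable (A ∨ B)] {w : ℝ} (hw : 0 ≤ w) :
    (if A ∨ B then w else 0) ≤ (if A then w else 0) + (if B then w else 0) := by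
  by_cases hA : A <;> by_cases hB : B <;> simp [hA, hB, hw]

/-- **Wave-6 glue, REGISTERED (`glue_invisibleThroughput_of_fast_and_dense`): the per-window INVISIBLE-collision
throughput `InvisibleCollisionThroughputW η` (DefsB § (a): fast OR mesoscopically dense endpoint) follows, at every
packing level `η`, from its FAST half `FastCollisionThroughputW η` (DefsB § (b), delivered by the Lanford envelope,
`stub_throughputOfEnvelopeR`) and its DENSE half, spelled inline: the same integrand with the indicator restricted to
the dense disjunct `(5/4) ρ_{s'}(xᵢ(s')) < (N+1)⁻¹ Σⱼ cone R N xᵢ(s') xⱼ(s')`, same quantifier shell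
`∀ t < T ∀ η' > 0 ∃ K₀ ∀ K ≥ K₀ ∀ R ≥ K₀ ∃ τ₀ > 0 ∀ τ ≥ τ₀ ∃ N₀ ∀ N ≥ N₀ ∀ s ∈ [0, t]`.**  Proof: both halves at `η'/2`;
thresholds merged by `σ₀ := min(σ₁, σ₂, 1/2)`, `K₀ := max`, `τ₀ := max`, `N₀ := max`; almost surely under the local
Gibbs law the datum is good, the collision times of the window are finitely many (`IsHardSphereTrajectory.locFinite`)
and `𝟙(A ∨ B) w ≤ 𝟙(A) w + 𝟙(B) w` termwise (`w ≥ 0`); the `lintegral` of the sum splits because the fast summand is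
a.e.-measurable (`aemeasurable_fastWindowThroughput`, §1); `η'/2 + η'/2 = η'` (`ENNReal.ofReal_add`). -/
theorem glue_invisibleThroughput_of_fast_and_dense : ∀ η : ℝ, Summit.AtomisticToContinuum.HydrodynamicLimit.Theorems.LTEInBand.FastCollisionThroughputW η → (∀ (a₀ θ₀ : Literature.MathematicalPhysics.KineticTheory.T3 → ℝ) (u₀ : Literature.MathematicalPhysics.KineticTheory.T3 → Literature.MathematicalPhysics.KineticTheory.V3), Continuous a₀ → Continuous θ₀ → Continuous u₀ → (∀ x, 0 < a₀ x) → (∀ x, 0 < θ₀ x) → ∃ σ₀ : ℝ, 0 < σ₀ ∧ ∀ σ : ℝ, 0 < σ → σ < σ₀ → ∀ (T : ℝ) (ρ θ : ℝ → Literature.MathematicalPhysics.KineticTheory.T3 → ℝ) (u : ℝ → Literature.MathematicalPhysics.KineticTheory.T3 → Literature.MathematicalPhysics.KineticTheory.V3), Literature.MathematicalPhysics.KineticTheory.IsHardSphereEulerSolution σ T ρ u θ → (∀ t ∈ Set.Ico 0 T, ∀ x, ρ t x * σ ^ 3 < η) → ∀ Φ : (N : ℕ) → Literature.Analysis.FluidPDE.HardSphereFlow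 (Literature.Analysis.FluidPDE.Torus.geometry (Fin 3)) (Literature.MathematicalPhysics.KineticTheory.hsDiameter σ N) (N + 1), Literature.MathematicalPhysics.KineticTheory.TendstoHydroFieldsAt (fun N => Literature.MathematicalPhysics.KineticTheory.localGibbsLaw σ a₀ u₀ θ₀ N (Φ N)) Φ ρ u θ 0 → ∀ t ∈ Set.Ico 0 T, ∀ η' : ℝ, 0 < η' → ∃ K₀ : ℝ, ∀ K : ℝ, K₀ ≤ K → ∀ R : ℝ, K₀ ≤ R → ∃ τ₀ : ℝ, 0 < τ₀ ∧ ∀ τ : ℝ, τ₀ ≤ τ → ∃ N₀ : ℕ, ∀ N : ℕ, N₀ ≤ N → ∀ s ∈ Set.Icc 0 t, ∫⁻ z, ENNReal.ofReal ((τ * ((N : ℝ) + 1))⁻¹ * ∑ i : Fin (N + 1), ∑ᶠ s' ∈ Literature.Analysis.FluidPDE.collisionTimes (Literature.Analysis.FluidPDE.Torus.geometry (Fin 3)) (Literature.MathematicalPhysics.KineticTheory.hsDiameter σ N) (fun r => (Φ N).flow r z) ∩ Set.Ioc s (s + τ * ((N : ℝ) + 1) ^ (-(1 / 3 : ℝ))),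 (if 5 / 4 * ρ s' ((Φ N).flow s' z i).1 < ((N : ℝ) + 1)⁻¹ * ∑ j : Fin (N + 1), Summit.AtomisticToContinuum.HydrodynamicLimit.Theorems.LTEInBand.cone R N ((Φ N).flow s' z i).1 ((Φ N).flow s' z j).1 then (1 + ‖((Φ N).flow s' z i).2 + (Function.leftLim (fun r => (Φ N).flow r z) s' i).2‖ / 2) * ‖((Φ N).flow s' z i).2 - (Function.leftLim (fun r => (Φ N).flow r z) s' i).2‖ else 0)) ∂(Literature.MathematicalPhysics.KineticTheory.localGibbsLaw σ a₀ u₀ θ₀ N (Φ N)) ≤ ENNReal.ofReal η') → Summit.AtomisticToContinuum.HydrodynamicLimit.Theorems.LTEInBand.InvisibleCollisionThroughputW η := by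
  intro η hF hD a₀ θ₀ u₀ ha hθ hu hap hθp
  obtain ⟨σ₁, hσ₁, G₁⟩ := hF a₀ θ₀ u₀ ha hθ hu hap hθp
  obtain ⟨σ₂, hσ₂, G₂⟩ := hD a₀ θ₀ u₀ ha hθ hu hap hθp
  refine ⟨min (min σ₁ σ₂) (1 / 2), lt_min (lt_min hσ₁ hσ₂) one_half_pos,
    fun σ hσ hσ' T ρ θ u hE hguard Φ hlim t ht η' hη' => ?_⟩
  have hσ1 : σ < σ₁ := hσ'.trans_le ((min_le_left _ _).trans (min_le_left _ _))
  have hσ2 : σ < σ₂ := hσ'.trans_le ((min_le_left _ _).trans (min_le_right _ _))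
  have hσh : σ < 1 / 2 := hσ'.trans_le (min_le_right _ _)
  have hη2 : 0 < η' / 2 := half_pos hη'
  obtain ⟨K₁, hK₁⟩ := G₁ σ hσ hσ1 T ρ θ u hE hguard Φ hlim t ht (η' / 2) hη2
  obtain ⟨K₂, hK₂⟩ := G₂ σ hσ hσ2 T ρ θ u hE hguard Φ hlim t ht (η' / 2) hη2
  refine ⟨max K₁ K₂, fun K hK R hR => ?_⟩
  obtain ⟨τ₁, hτ₁, H₁⟩ := hK₁ K ((le_max_left _ _).trans hK)
  obtain ⟨τ₂, _, H₂⟩ := hK₂ K ((le_max_right _ _).trans hK) R ((le_max_right _ _).trans hR)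
  refine ⟨max τ₁ τ₂, lt_max_of_lt_left hτ₁, fun τ hτ => ?_⟩
  obtain ⟨N₁, hN₁⟩ := H₁ τ ((le_max_left _ _).trans hτ)
  obtain ⟨N₂, hN₂⟩ := H₂ τ ((le_max_right _ _).trans hτ)
  refine ⟨max N₁ N₂, fun N hN s hs => ?_⟩
  have hA := hN₁ N ((le_max_left _ _).trans hN) s hs
  have hB := hN₂ N ((le_max_right _ _).trans hN) s hs
  have hτ0 : 0 < τ := (lt_max_of_lt_left hτ₁).trans_le hτ
  -- the true law is carried by the good set; the fast summand is a.e.-measurable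
  have hPgood : localGibbsLaw σ a₀ u₀ θ₀ N (Φ N) (Φ N).goodᶜ = 0 := by
    rw [localGibbsLaw_eq]
    exact localGibbsMeasure_absolutelyContinuous σ a₀ u₀ θ₀ N (Φ N) (Φ N).measure_compl_good
  have hgood : ∀ᵐ z ∂(localGibbsLaw σ a₀ u₀ θ₀ N (Φ N)), z ∈ (Φ N).good := mem_ae_iff.2 hPgood
  have hmeas := aemeasurable_fastWindowThroughput hσ hσh (Φ N) (localGibbsLaw σ a₀ u₀ θ₀ N (Φ N)) hPgood
    K ((τ * ((N : ℝ) + 1))⁻¹) s (τ * ((N : ℝ) + 1) ^ (-(1 / 3 : ℝ)))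
  refine (lintegral_mono_ae ?_).trans
    (((lintegral_add_left' hmeas _).trans_le (add_le_add hA hB)).trans_eq ?_)
  · -- termwise on the good set: `𝟙(A ∨ B) w ≤ 𝟙(A) w + 𝟙(B) w`
    filter_upwards [hgood] with z hz
    have hfin : (collisionTimes (Torus.geometry (Fin 3)) (hsDiameter σ N) (fun r => (Φ N).flow r z) ∩
        Set.Ioc s (s + τ * ((N : ℝ) + 1) ^ (-(1 / 3 : ℝ)))).Finite :=
      (((Φ N).isTrajectory z hz).locFinite s _).subset (Set.inter_subset_inter_right _ Set.Ioc_subset_Icc_self)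
    simp only [finsum_mem_eq_finite_toFinset_sum _ hfin]
    rw [← ENNReal.ofReal_add (by positivity) (by positivity), ← mul_add, ← Finset.sum_add_distrib]
    refine ENNReal.ofReal_le_ofReal (mul_le_mul_of_nonneg_left (Finset.sum_le_sum fun i _ => ?_) (by positivity))
    rw [← Finset.sum_add_distrib]
    refine Finset.sum_le_sum fun s' _ => ?_
    have hw : 0 ≤ (1 + ‖((Φ N).flow s' z i).2 + (Function.leftLim (fun r => (Φ N).flow r z) s' i).2‖ / 2) *
        ‖((Φ N).flow s' z i).2 - (Function.leftLim (fun r => (Φ N).flow r z) s' i).2‖ := by positivity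
    exact ite_or_le_add hw
  · rw [← ENNReal.ofReal_add hη2.le hη2.le, add_halves]

end Summit.AtomisticToContinuum.HydrodynamicLimit.Theorems.LTEInBand

end
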